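import Mathlib
import HarnessLib
import HarnessLib.Audit
import Literature.Analysis.FunctionSpaces.BesselJZeroSqrtLaplace
import Summits.ValiantsHypothesis.ValiantsHypothesis.Theorems.LacunarySymmetroidMatrixDescartesToyALawDefs
import Summits.ValiantsHypothesis.ValiantsHypothesis.Theorems.LacunarySymmetroidMatrixDescartesToyALawSignChanges
import Summits.ValiantsHypothesis.ValiantsHypothesis.Theorems.LacunarySymmetroidMatrixDescartesToyALawExpPoly
import Summits.ValiantsHypothesis.ValiantsHypothesis.Theorems.LacunarySymmetroidMatrixDescartesToyALawMultiplier
import Summits.ValiantsHypothesis.ValiantsHypothesis.Theorems.LacunarySymmetroidMatrixDescartesToyALawLaplace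

/-!
# ValiantsHypothesis / LacunarySymmetroid — crux `MatrixDescartes` (stmt-ValiantsHypothesis-18050, V1), LINE (A) «product_plus_one»:
# binomial-limit TOY THEOREM, module 7 — the POLYNOMIAL LADDER (pen NOTE §54.15(b))

**POLYNOMIAL LADDER** (pen val-idea-25 g8 NOTE §54.15(b), refereed PASS by val-idea-crit-1 g10 #383; sign-free): for `t_f > 0` and
real polynomials `H_f` of degree `≤ n` with `H_f(0) = H_f′(0) = 0`, the function `Y ↦ Σ_f H_f(t_f/(Y + t_f))` has at most
`r(n−1) − 1` zeros on `(0,∞)` counted with multiplicity, i.e. its numerator `ladderNum` over `ladderDen = ∏_f (X + t_f)^n` has at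
most `r(n−1) − 1` positive roots counted with multiplicity (`polyLadder`).  Proof: `p^k = t^k/(Y+t)^k = (t^k/(k−1)!)·∫₀^∞θ^{k−1}
e^{−(Y+t)θ}dθ`, so the Laplace density is `θ·Σ_f e^{−t_fθ}Q_f(θ)` with `deg Q_f ≤ n − 2`; modules 2/4/5 (Pólya–Szegő V.75 + V.80).
`n = 3`, `H_f = λ_f(X² − (1+τ)X³)` is the TOY THEOREM of module 6.

HONEST FRAMING: a free-standing kernel theorem about Laplace-type toy sums (the reusable statement a near-binomial corner of
LINE (A) would import); no stub of LINE (A) is touched (A40 unchanged, sorries 4 → 4); `MatrixDescartes` OPEN; `VP ≠ VNP` is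
NOT proved and nothing here bears on it.
-/

set_option linter.dupNamespace false

namespace Summit.ValiantsHypothesis.ValiantsHypothesis.Theorems.LacunarySymmetroidMatrixDescartes

namespace ToyALaw

open Polynomial Finset MeasureTheory Filter
open Literature.Analysis.FunctionSpaces (integral_pow_mul_exp_neg_mul_Ioi integrableOn_pow_mul_exp_neg_mul_Ioi)

variable {r : ℕ} (n : ℕ) (t : Fin r → ℝ) (H : Fin r → ℝ[X])

/-- `ladderDen(Y) = ∏_f (Y + t_f)^n`. -/
theorem ladderDen_eval (Y : ℝ) : (ladderDen n t).eval Y = ∏ f, (Y + t f) ^ n := by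
  simp [ladderDen, eval_prod]

/-- `ladderDen(Y) ≠ 0` away from the poles. -/
theorem ladderDen_eval_ne_zero {Y : ℝ} (h : ∀ f, Y + t f ≠ 0) : (ladderDen n t).eval Y ≠ 0 := by
  rw [ladderDen_eval]
  exact prod_ne_zero_iff.2 fun f _ => pow_ne_zero n (h f)

/-- **Meaning lemma**: `Σ_f H_f(t_f/(Y + t_f)) = ladderNum(Y)/ladderDen(Y)` away from the poles (`deg H_f ≤ n`). -/
theorem ladder_eval_div (hdeg : ∀ f, (H f).natDegree ≤ n) {Y : ℝ} (h : ∀ f, Y + t f ≠ 0) :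
    ∑ f, (H f).eval (t f / (Y + t f)) = (ladderNum n t H).eval Y / (ladderDen n t).eval Y := by
  rw [ladderDen_eval, ladderNum, eval_finsetSum, sum_div]
  refine sum_congr rfl fun f _ => ?_
  rw [eval_mul, eval_prod, ← mul_prod_erase univ (fun f' => (Y + t f') ^ n) (mem_univ f)]
  have hP : ∏ f' ∈ univ.erase f, (X + C (t f')).eval Y ^ n = ∏ f' ∈ univ.erase f, (Y + t f') ^ n :=
    prod_congr rfl fun f' _ => by simp [eval_add, eval_X, eval_C]
  simp only [eval_pow, hP]
  have hPne : ∏ f' ∈ univ.erase f, (Y + t f') ^ n ≠ 0 := prod_ne_zero_iff.2 fun f' _ => pow_ne_zero n (h f')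
  have hn : (Y + t f) ^ n ≠ 0 := pow_ne_zero n (h f)
  rw [mul_div_mul_right _ _ hPne, eval_eq_sum_range' (lt_of_le_of_lt (hdeg f) (Nat.lt_succ_self n)), eval_finsetSum,
    sum_div]
  refine sum_congr rfl fun k hk => ?_
  have hk' : k ≤ n := Nat.lt_succ_iff.1 (mem_range.1 hk)
  simp only [eval_mul, eval_C, eval_pow, eval_add, eval_X]
  rw [div_pow, show (Y + t f) ^ n = (Y + t f) ^ (n - k) * (Y + t f) ^ k by rw [← pow_add, Nat.sub_add_cancel hk']]
  have h1 : (Y + t f) ^ (n - k) ≠ 0 := pow_ne_zero _ (h f)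
  have h2 : (Y + t f) ^ k ≠ 0 := pow_ne_zero _ (h f)
  field_simp

/-- **Laplace representation of the ladder**: for `t_f > 0`, `H_f(0) = 0` and `Y > 0`,
`∫₀^∞ e^{−Yθ} Σ_f Σ_{k≤n} H_f[k]·t_f^k/(k−1)!·θ^{k−1}e^{−t_fθ} dθ = Σ_f Σ_{k ≤ n} H_f[k]·(t_f/(Y+t_f))^k`. -/
theorem integral_ladderDensity (ht : ∀ f, 0 < t f) (h0 : ∀ f, (H f).coeff 0 = 0) {Y : ℝ} (hY : 0 < Y) :
    ∫ θ in Set.Ioi 0, Real.exp (-(Y * θ)) *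
        ∑ f, ∑ k ∈ range (n + 1), (H f).coeff k * t f ^ k / (k - 1).factorial * (θ ^ (k - 1) * Real.exp (-(t f * θ))) =
      ∑ f, ∑ k ∈ range (n + 1), (H f).coeff k * (t f / (Y + t f)) ^ k := by
  have hp : ∀ f, 0 < Y + t f := fun f => by linarith [ht f]
  have hexp : ∀ f (θ : ℝ) (k : ℕ), Real.exp (-(Y * θ)) * (θ ^ k * Real.exp (-(t f * θ))) =
      θ ^ k * Real.exp (-((Y + t f) * θ)) := by
    intro f θ k
    rw [show -((Y + t f) * θ) = -(Y * θ) + -(t f * θ) by ring, Real.exp_add]; ring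
  have hpt : ∀ θ : ℝ, Real.exp (-(Y * θ)) *
      ∑ f, ∑ k ∈ range (n + 1), (H f).coeff k * t f ^ k / (k - 1).factorial * (θ ^ (k - 1) * Real.exp (-(t f * θ))) =
      ∑ f, ∑ k ∈ range (n + 1), (H f).coeff k * t f ^ k / (k - 1).factorial *
        (θ ^ (k - 1) * Real.exp (-((Y + t f) * θ))) := by
    intro θ
    rw [mul_sum]
    refine sum_congr rfl fun f _ => ?_
    rw [mul_sum]
    refine sum_congr rfl fun k _ => ?_
    rw [← hexp f θ (k - 1)]; ring
  rw [integral_congr_ae (Eventually.of_forall hpt)]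
  have hint : ∀ f (k : ℕ) (a : ℝ),
      IntegrableOn (fun θ : ℝ => a * (θ ^ k * Real.exp (-((Y + t f) * θ)))) (Set.Ioi 0) :=
    fun f k a => (integrableOn_pow_mul_exp_neg_mul_Ioi (hp f) k).const_mul a
  have hintf : ∀ f, Integrable (fun θ : ℝ => ∑ k ∈ range (n + 1), (H f).coeff k * t f ^ k / (k - 1).factorial *
      (θ ^ (k - 1) * Real.exp (-((Y + t f) * θ)))) (volume.restrict (Set.Ioi 0)) :=
    fun f => integrable_finsetSum _ fun k _ => hint f (k - 1) _
  rw [integral_finsetSum univ (fun f _ => hintf f)]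
  refine sum_congr rfl fun f _ => ?_
  rw [integral_finsetSum _ (fun k _ => hint f (k - 1) _)]
  refine sum_congr rfl fun k _ => ?_
  rw [integral_const_mul, integral_pow_mul_exp_neg_mul_Ioi (hp f) (k - 1)]
  rcases Nat.eq_zero_or_pos k with rfl | hk
  · simp [h0 f]
  · rw [Nat.sub_add_cancel hk, div_pow]
    have hfac : ((k - 1).factorial : ℝ) ≠ 0 := by positivity
    have hpk : (Y + t f) ^ k ≠ 0 := pow_ne_zero _ (hp f).ne'
    field_simp

/-- The ladder density is dominated by a polynomial on `(0, ∞)`. -/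
theorem abs_ladderDensity_le (ht : ∀ f, 0 < t f) (θ : ℝ) (hθ : 0 < θ) :
    |∑ f, ∑ k ∈ range (n + 1), (H f).coeff k * t f ^ k / (k - 1).factorial * (θ ^ (k - 1) * Real.exp (-(t f * θ)))| ≤
      (∑ f, ∑ k ∈ range (n + 1), C |(H f).coeff k * t f ^ k / (k - 1).factorial| * X ^ (k - 1)).eval θ := by
  rw [eval_finsetSum]
  refine (abs_sum_le_sum_abs _ _).trans (sum_le_sum fun f _ => ?_)
  rw [eval_finsetSum]
  refine (abs_sum_le_sum_abs _ _).trans (sum_le_sum fun k _ => ?_)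
  simp only [eval_mul, eval_C, eval_pow, eval_X]
  have he : Real.exp (-(t f * θ)) ≤ 1 := Real.exp_le_one_iff.2 (by nlinarith [ht f])
  have he0 : 0 < Real.exp (-(t f * θ)) := Real.exp_pos _
  rw [abs_mul ((H f).coeff k * t f ^ k / (k - 1).factorial), abs_mul (θ ^ (k - 1)), abs_of_pos (pow_pos hθ _),
    abs_of_pos he0]
  calc |(H f).coeff k * t f ^ k / (k - 1).factorial| * (θ ^ (k - 1) * Real.exp (-(t f * θ)))
      ≤ |(H f).coeff k * t f ^ k / (k - 1).factorial| * (θ ^ (k - 1) * 1) := by gcongr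
    _ = _ := by ring

/-- **Sign changes of the ladder density**: with `H_f(0) = H_f′(0) = 0`, the density is `θ·Σ_{s∈S} e^{sθ}P_s(θ)` over
`S = {−t_f}` with `deg P_s ≤ n − 2`, so `V_{(0,∞)} ≤ |S|·(n−1) − 1` (module 2), or the density vanishes identically. -/
theorem signChangesLE_ladderDensity (h0 : ∀ f, (H f).coeff 0 = 0) (h1 : ∀ f, (H f).coeff 1 = 0) :
    SignChangesLE (fun θ => ∑ f, ∑ k ∈ range (n + 1), (H f).coeff k * t f ^ k / (k - 1).factorial *
        (θ ^ (k - 1) * Real.exp (-(t f * θ)))) (Set.Ioi 0) ((Finset.univ.image (fun f => -t f)).card * (n - 1) - 1) := by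
  classical
  set c : Fin r → ℕ → ℝ := fun f k => (H f).coeff k * t f ^ k / (k - 1).factorial with hc
  set Q : Fin r → ℝ[X] := fun f => ∑ k ∈ range (n + 1), C (c f k) * X ^ (k - 2) with hQ
  set S : Finset ℝ := Finset.univ.image (fun f => -t f) with hS
  set P : ℝ → ℝ[X] := fun s => ∑ f ∈ univ.filter (fun f => -t f = s), Q f with hP
  have hc01 : ∀ f k, k < 2 → c f k = 0 := by
    intro f k hk
    rcases (by omega : k = 0 ∨ k = 1) with rfl | rfl
    · simp [hc, h0 f]
    · simp [hc, h1 f]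
  -- degrees
  have hQdeg : ∀ f, (Q f).natDegree ≤ n - 2 := fun f =>
    natDegree_sum_le_of_forall_le _ _ fun k hk =>
      (natDegree_C_mul_X_pow_le _ _).trans (by have := mem_range.1 hk; omega)
  have hPdeg : ∀ s, (P s).natDegree ≤ n - 2 := fun s =>
    natDegree_sum_le_of_forall_le _ _ fun f _ => hQdeg f
  -- pointwise identity
  have key : ∀ θ : ℝ, expPoly S P θ = ∑ f, Real.exp (-(t f * θ)) * (Q f).eval θ := by
    intro θ
    rw [expPoly, ← sum_fiberwise_of_maps_to (s := univ) (t := S) (g := fun f => -t f)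
      (fun f _ => mem_image_of_mem _ (mem_univ f))]
    refine sum_congr rfl fun s _ => ?_
    simp only [hP, eval_finsetSum]
    rw [mul_sum]
    refine sum_congr rfl fun f hf => ?_
    rw [(mem_filter.1 hf).2.symm, neg_mul]
  have hfun : ∀ θ ∈ Set.Ioi (0 : ℝ), (fun θ => θ * expPoly S P θ) θ =
      ∑ f, ∑ k ∈ range (n + 1), (H f).coeff k * t f ^ k / (k - 1).factorial *
        (θ ^ (k - 1) * Real.exp (-(t f * θ))) := by
    intro θ _
    show θ * expPoly S P θ = _
    rw [key θ, mul_sum]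
    refine sum_congr rfl fun f _ => ?_
    simp only [hQ, eval_finsetSum, eval_mul, eval_C, eval_pow, eval_X]
    rw [mul_sum, mul_sum]
    refine sum_congr rfl fun k _ => ?_
    by_cases hk : k < 2
    · rw [show (H f).coeff k * t f ^ k / (k - 1).factorial = c f k from rfl, hc01 f k hk]; ring
    · have e : θ * θ ^ (k - 2) = θ ^ (k - 1) := by
        rw [← pow_succ']; congr 1; omega
      rw [show (H f).coeff k * t f ^ k / (k - 1).factorial = c f k from rfl, ← e]; ring
  by_cases hex : ∃ s ∈ S, P s ≠ 0
  · -- then n ≥ 2 (for n ≤ 1 every Q f vanishes)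
    have hn : 2 ≤ n := by
      by_contra hn
      push Not at hn
      obtain ⟨s, _, hs⟩ := hex
      apply hs
      simp only [hP]
      refine sum_eq_zero fun f _ => ?_
      simp only [hQ]
      refine sum_eq_zero fun k hk => ?_
      rw [hc01 f k (by have := mem_range.1 hk; omega), map_zero, zero_mul]
    have hE := signChangesLE_expPoly S P hex
    have hbound : ∑ s ∈ S, ((P s).natDegree + 1) - 1 ≤ S.card * (n - 1) - 1 := by
      have : ∑ s ∈ S, ((P s).natDegree + 1) ≤ ∑ s ∈ S, (n - 1) :=
        sum_le_sum fun s _ => by have := hPdeg s; omega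
      rw [sum_const, smul_eq_mul] at this
      omega
    have h1' : SignChangesLE (expPoly S P) (Set.Ioi 0) (S.card * (n - 1) - 1) :=
      (hE.mono hbound).anti (Set.subset_univ _)
    exact (h1'.mul_pos (w := fun θ => θ) fun θ hθ => hθ).congr hfun
  · push Not at hex
    have hz : ∀ θ ∈ Set.Ioi (0 : ℝ), expPoly S P θ = 0 := by
      intro θ _
      rw [expPoly]
      exact sum_eq_zero fun s hs => by rw [hex s hs]; simp
    have h1' : SignChangesLE (fun θ => θ * expPoly S P θ) (Set.Ioi 0) 0 :=
      signChangesLE_of_nonneg fun θ hθ => by rw [hz θ hθ, mul_zero]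
    exact (h1'.mono (Nat.zero_le _)).congr hfun

/-- **POLYNOMIAL LADDER (pen NOTE §54.15(b), kernel version; sign-free, with multiplicity).**  For `t_f > 0` and real polynomials
`H_f` with `deg H_f ≤ n`, `H_f(0) = H_f′(0) = 0`, the numerator `ladderNum` of `Σ_f H_f(t_f/(Y + t_f))` has at most `r(n−1) − 1`
positive roots counted with multiplicity (`n = 3`: the TOY THEOREM `toyALaw`). -/
theorem polyLadder (ht : ∀ f, 0 < t f) (hdeg : ∀ f, (H f).natDegree ≤ n) (h0 : ∀ f, (H f).coeff 0 = 0)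
    (h1 : ∀ f, (H f).coeff 1 = 0) :
    Multiset.card ((ladderNum n t H).roots.filter (fun Y => 0 < Y)) ≤ r * (n - 1) - 1 := by
  classical
  set g : ℝ → ℝ := fun θ => ∑ f, ∑ k ∈ range (n + 1), (H f).coeff k * t f ^ k / (k - 1).factorial *
    (θ ^ (k - 1) * Real.exp (-(t f * θ))) with hg
  have hgc : ContinuousOn g (Set.Ioi 0) := (by rw [hg]; fun_prop : Continuous g).continuousOn
  have hB := abs_ladderDensity_le n t H ht
  have hSC := signChangesLE_ladderDensity n t H h0 h1
  obtain ⟨V, hV, c, -, hsign⟩ :=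
    exists_multiplier_of_signChangesLE (I := Set.Ioi 0) Set.ordConnected_Ioi hgc hSC
  have hD : ∀ Y : ℝ, 0 < Y → (ladderDen n t).eval Y ≠ 0 := fun Y hY =>
    ladderDen_eval_ne_zero n t fun f => by linarith [ht f]
  have hL : ∀ Y : ℝ, 0 < Y → (ladderNum n t H).eval Y / (ladderDen n t).eval Y =
      ∫ θ in Set.Ioi 0, Real.exp (-(Y * θ)) * g θ := by
    intro Y hY
    rw [← ladder_eval_div n t H hdeg (fun f => by linarith [ht f]), hg, integral_ladderDensity n t H ht h0 hY]
    refine sum_congr rfl fun f _ => ?_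
    exact eval_eq_sum_range' (lt_of_le_of_lt (hdeg f) (Nat.lt_succ_self n)) _
  have hmain := card_posRoots_le_of_laplace_multiplier V g _ (ladderNum n t H) (ladderDen n t) c hgc hB hD hL hsign
  have hS : (Finset.univ.image (fun f : Fin r => -t f)).card ≤ r :=
    card_image_le.trans (by rw [Finset.card_univ, Fintype.card_fin])
  have hmono : (Finset.univ.image (fun f : Fin r => -t f)).card * (n - 1) ≤ r * (n - 1) := Nat.mul_le_mul_right _ hS
  omega

end ToyALaw

end Summit.ValiantsHypothesis.ValiantsHypothesis.Theorems.LacunarySymmetroidMatrixDescartes
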